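import Summits.ValiantsHypothesis.ValiantsHypothesis.Theorems.LMRWhatWouldSufficeTyped
import Literature.Computability.AlgebraicComplexity.Yab15BRankGrowth
import Literature.Computability.AlgebraicComplexity.Yab15BRankMainTheorem
import HarnessLib

/-!
# LMR corpus — "what would suffice", part 4 («LWS4.»): Yabe's template is now KERNEL-CHECKED

Sibling of `LMRWhatWouldSufficeTyped` (part 2, «LWS2.»). Part 2's rung link
`LWS2.detqpSuperquadratic_of_yabeProgramme` carried Yabe 2015 Cor. 1.6 as a NAMED-FACT binder
`(h16 : yabe2015_cor_1_6)`. Since then the cell has DISCHARGED the whole printed template: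

* `yabe2015_thm_1_5_holds` (Yabe 2015 Thm. 1.5, typed with denominators cleared:
  `brank((p_{x₀})^{(2k)}) ≤ 2^{2k−2}·(dc(p) + 2(k−1)·D^{k−1})` at a zero `x₀` of `p`, `1 ≤ k ≤ D`, any
  field — file `Yab15BRankMainTheorem.lean`, val-lit p7, assembling `Yab15BRankProofs` (Lemmas 2.8, 5.1),
  `Yab15BRankProp52` (Prop. 5.2 via clow sequences) and `Yab15BRankLowDegree` (Lemma 5.3 (i) + the
  det-of-linear brank bound replacing Lemma 5.3 (ii)));
* `yabe2015_cor_1_6_of_thm_1_5 : yabe2015_thm_1_5 → yabe2015_cor_1_6` (file `Yab15BRankGrowth.lean`,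
  val-lit p8).

Hence the binder `h16` can be DROPPED: the only remaining hypothesis of the Yabe rung link is the
brank GROWTH hypothesis at zeros of `per_d` — Yabe's own open problem (arXiv:1504.00151 p. 3: "we do
not know any explicit sequence of zeros with large brank"). This file records exactly that.

HONEST FRAMING. The conclusion is `DetQP.DetqpSuperquadratic` (stmt-0318: `dc(per_n) ≥ n^{2+ε}`
eventually), NOT `DetqpThesis` (0315) and not `ValiantsHypothesis`: a fixed `k` gives a POLYNOMIAL lower
bound `d^{2k}`-ish, never a super-quasi-polynomial one. Nothing here is progress on VP ≠ VNP; the open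
input `hX` is as open as it was in 2015.
-/

namespace Summit.ValiantsHypothesis.ValiantsHypothesis.Theorems.LMRWhatWouldSufficeYabe

open Literature.Computability.AlgebraicComplexity
open Summit.ValiantsHypothesis.ValiantsHypothesis.Theorems.LMRWhatWouldSufficeTyped
open MvPolynomial

/-- **Yabe 2015, Cor. 1.6 is now a THEOREM of the tree** (Thm. 1.5 discharged by val-lit p7,
Cor. 1.6 ⇐ Thm. 1.5 by val-lit p8). [cite: Yabe2015, Thm. 1.5, Cor. 1.6] -/
theorem yabe2015_cor_1_6_holds' : yabe2015_cor_1_6.{0} :=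
  yabe2015_cor_1_6_of_thm_1_5 yabe2015_thm_1_5_holds

/-- **The Yabe rung link with NO literature binder.** If for some fixed `k ≥ 2` there are zeros `X d` of
`per_d` at which the `k`-th brank of the degree-`2k` Taylor component grows like `c·d^{2k}`, then
`dc(per_d) ≥ c'·d^{2+ε}` eventually, i.e. `DetQP.DetqpSuperquadratic` (stmt-ValiantsHypothesis-0318).
All of Yabe's printed template (Thm. 1.5 ⇒ Cor. 1.6) is kernel-checked; `hX` is the one OPEN input.
[cite: Yabe2015, Cor. 1.6 and the programme of §1, p. 3] -/
theorem detqpSuperquadratic_of_brankGrowthAtZeros {k : ℕ} (hk : 2 ≤ k)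
    (X : (d : ℕ) → (Fin d × Fin d → ℂ))
    (hX0 : ∀ d, 1 ≤ d → eval (X d) (perPoly (Fin d) ℂ) = 0)
    (hX : ∃ c : ℝ, 0 < c ∧ ∃ N : ℕ, ∀ d ≥ N,
      c * (d : ℝ) ^ (2 * k) ≤
        bRank k (homogeneousComponent (2 * k) (transl (X d) (perPoly (Fin d) ℂ)))) :
    Theses.DetQP.DetqpSuperquadratic :=
  detqpSuperquadratic_of_yabeProgramme yabe2015_cor_1_6_holds' hk X hX0 hX

end Summit.ValiantsHypothesis.ValiantsHypothesis.Theorems.LMRWhatWouldSufficeYabe
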